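import Literature.NumberTheory.Sieve.GoldbachLinnikRomanovCertDefs
import Literature.NumberTheory.Sieve.GoldbachLinnikRomanovCertData1
import Literature.NumberTheory.Sieve.GoldbachLinnikRomanovCertData2

/-!
# Romanov certificate — head sums 4/7

Kernel evaluation (`decide +kernel`) of the checker of `GoldbachLinnikRomanovCertDefs.lean` on the records
`parseRecs 20000 (digitsOf (fsegs1 ++ fsegs2))` of `GoldbachLinnikRomanovCertData1/2.lean`; soundness: `GoldbachLinnikRomanovCertSound1.lean`,
`GoldbachLinnikRomanovCertTop.lean`. [folklore]
-/

namespace Literature.NumberTheory.Sieve.RomanovCert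

set_option maxHeartbeats 0 in
/-- The head accumulators `(T⁺, T⁻, I, S⁺, S⁻, ok)` on `d ∈ [2048, 4096)`. [folklore] -/
theorem head_2048 : headSums (parseRecs 20000 (digitsOf (fsegs1 ++ fsegs2))) 2048 2048 = (1942096233591092627, 1932590296480565666, 83233499795998, 12855050014304031215178, 21428363454050605309787, true) := by
  decide +kernel

set_option maxHeartbeats 0 in
/-- The head accumulators `(T⁺, T⁻, I, S⁺, S⁻, ok)` on `d ∈ [4096, 8192)`. [folklore] -/
theorem head_4096 : headSums (parseRecs 20000 (digitsOf (fsegs1 ++ fsegs2))) 4096 4096 = (1654990175844968744, 1542533447510775979, 161671229810707, 12196602115726108536178, 25090027477674812934886, true) := by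
  decide +kernel

end Literature.NumberTheory.Sieve.RomanovCert
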